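import Summits.MatrixMultiplication.OmegaCensus.CycloRing7
import Summits.MatrixMultiplication.OmegaCensus.ZetaBlocks

/-!
# ω-census, family (b3): conjecture C9 — 6-D HALF BLOCKS (phases mod 2) for `(ℤ[ζ₇]/p) ⋊ C₇`: independence and count

HONEST FRAMING (pub-omega census; verbatim): lottery ticket; floor = certified bounds/negative ranges.
Census BOOKKEEPING (conjecture C9 of the cell; pub-omega stpp-1 gen 22).  `ZetaBlocks.lean` with SIX coordinates (`x.v k`, `k : Fin 6`,
of the coordinate type `Z7 p`, `CycloRing7.lean`) instead of four: phase vectors `φ : Fin 6 → ℤ` (entries in `{0,1}`), trims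
`Fin 6 → ℕ`, cells = unions over `φ ∈ P c` of products of six trimmed half intervals (`blockCells7`), **`patIndep_blockCells7`**
(independent when every pair of columns / phase vectors passes `ZetaArcs.PairOK2` in SOME coordinate; one coordinate =
`ZetaArcs.coord_noConflict2`), the explicit arc set `blockArcSet7` (images of `Fintype.piFinset` index boxes) `⊆ blockCells7`, and its
exact count **`card_blockArcSet7 = Σ_c Σ_φ Π_k len_k`**.  Nothing here is progress on `ω`.
-/

namespace Summit.MatrixMultiplication.OmegaCensus

open Finset

namespace Cyclo7

open ZetaArcs (PairOK2 InBlk bStart2 bStop2 bLen2 b_bounds2 coord_noConflict2)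

variable {p : ℕ} [Fact (1 < p)]

/-- The 6-D half-block cell set. [folklore] -/
def blockCells7 (p : ℕ) [Fact (1 < p)] [NeZero p] (P : Fin 3 × Fin 3 → Finset (Fin 6 → ℤ))
    (lo hi : Fin 3 × Fin 3 → (Fin 6 → ℤ) → Fin 6 → ℕ) : Finset ((Fin 3 × Fin 3) × Z7 p) :=
  univ.filter fun x => ∃ φ ∈ P x.1, ∀ k : Fin 6, InBlk p (φ k) (lo x.1 φ k) (hi x.1 φ k) (x.2.v k)

omit [Fact (1 < p)] in
/-- Membership in the block cell set. [folklore] -/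
theorem mem_blockCells7 [Fact (1 < p)] [NeZero p] {P : Fin 3 × Fin 3 → Finset (Fin 6 → ℤ)}
    {lo hi : Fin 3 × Fin 3 → (Fin 6 → ℤ) → Fin 6 → ℕ} {x : (Fin 3 × Fin 3) × Z7 p} :
    x ∈ blockCells7 p P lo hi ↔ ∃ φ ∈ P x.1, ∀ k : Fin 6, InBlk p (φ k) (lo x.1 φ k) (hi x.1 φ k) (x.2.v k) := by
  simp only [blockCells7, mem_filter, mem_univ, true_and]

/-- **6-D half blocks are independent** when every pair of columns / phase vectors passes `PairOK2` in SOME coordinate. [folklore] -/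
theorem patIndep_blockCells7 [NeZero p] (D : RCyc.RBox (Z7 p) 7)
    (aα eα aβ eβ : Fin 6 → ZMod 7 → Fin 3 → ℤ)
    (hα : ∀ k s i, 2 * (((RCyc.act Z7.zeta s * D.α i).v k).val : ℤ) = aα k s i * p + eα k s i)
    (hβ : ∀ k s j, 2 * (((RCyc.act Z7.zeta s * D.β j).v k).val : ℤ) = aβ k s j * p + eβ k s j)
    (P : Fin 3 × Fin 3 → Finset (Fin 6 → ℤ)) (lo hi : Fin 3 × Fin 3 → (Fin 6 → ℤ) → Fin 6 → ℕ)
    (hcond : ∀ c c', c ≠ c' → ∀ φ ∈ P c, ∀ φ' ∈ P c', ∃ k : Fin 6,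
      PairOK2 p (EisArcs.PhiR D (aα k) (aβ k) c c') (EisArcs.PhiR D (eα k) (eβ k) c c') (φ k) (φ' k)
        ((lo c φ k : ℕ) : ℤ) ((hi c φ k : ℕ) : ℤ) ((lo c' φ' k : ℕ) : ℤ) ((hi c' φ' k : ℕ) : ℤ)) :
    D.PatIndep Z7.zeta (blockCells7 p P lo hi) := by
  intro x hx y hy hxy heq
  obtain ⟨φ, hφ, hxk⟩ := mem_blockCells7.1 hx
  obtain ⟨φ', hφ', hyk⟩ := mem_blockCells7.1 hy
  by_cases hc : x.1 = y.1
  · rw [hc, RCyc.RBox.dd_self, sub_eq_zero] at heq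
    exact hxy (Prod.ext hc heq)
  rw [RCyc.RBox.dd_eq_four] at heq
  obtain ⟨k, hok⟩ := hcond x.1 y.1 hc φ hφ φ' hφ'
  have hk := congrArg (fun z : Z7 p => z.v k) heq
  simp only [Z7.sub_v, Z7.add_v, Pi.sub_apply, Pi.add_apply] at hk
  obtain ⟨hx1, hx2⟩ := hxk k
  obtain ⟨hy1, hy2⟩ := hyk k
  exact coord_noConflict2 hk (hα k _ y.1.1) (hβ k _ x.1.2) (hβ k _ y.1.2) (hα k _ x.1.1)
    (Nat.cast_nonneg _) (Nat.cast_nonneg _) (Nat.cast_nonneg _) (Nat.cast_nonneg _) hx1 hx2 hy1 hy2 hok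

/-! ### The explicit product arc set and its count -/

/-- The index box of a block: functions `Fin 6 → ℤ` with each value in its arc. [folklore] -/
noncomputable def idxBox7 (p : ℕ) (φ : Fin 6 → ℤ) (l h : Fin 6 → ℕ) : Finset (Fin 6 → ℤ) :=
  Fintype.piFinset fun k => Icc (bStart2 p (φ k) (l k)) (bStop2 p (φ k) (h k))

/-- The element with integer coordinates `n`. [folklore] -/
def ofIdx7 (p : ℕ) (n : Fin 6 → ℤ) : Z7 p := ⟨fun k => (n k : ZMod p)⟩

/-- The number of cells of a block: the product of the six arc lengths. [folklore] -/
def blkCount7 (p : ℕ) (φ : Fin 6 → ℤ) (l h : Fin 6 → ℕ) : ℕ := ∏ k, (bLen2 p (φ k) (l k) (h k)).toNat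

/-- The explicit arc set. [folklore] -/
noncomputable def blockArcSet7 (p : ℕ) [Fact (1 < p)] [NeZero p] (P : Fin 3 × Fin 3 → Finset (Fin 6 → ℤ))
    (lo hi : Fin 3 × Fin 3 → (Fin 6 → ℤ) → Fin 6 → ℕ) : Finset ((Fin 3 × Fin 3) × Z7 p) :=
  (univ : Finset (Fin 3 × Fin 3)).biUnion fun c => (P c).biUnion fun φ =>
    (idxBox7 p φ (lo c φ) (hi c φ)).image fun n => (c, ofIdx7 p n)

section

variable [NeZero p] {P : Fin 3 × Fin 3 → Finset (Fin 6 → ℤ)} {lo hi : Fin 3 × Fin 3 → (Fin 6 → ℤ) → Fin 6 → ℕ}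
  (hP : ∀ c, ∀ φ ∈ P c, ∀ k, 0 ≤ φ k ∧ φ k < 2)
include hP

omit [Fact (1 < p)] [NeZero p] in
/-- Index boxes: every index satisfies the bounds of its coordinate. [folklore] -/
theorem idx_bounds7 (c : Fin 3 × Fin 3) {φ : Fin 6 → ℤ} (hφ : φ ∈ P c) {n : Fin 6 → ℤ}
    (hn : n ∈ idxBox7 p φ (lo c φ) (hi c φ)) (k : Fin 6) :
    0 ≤ n k ∧ n k < p ∧ φ k * p + lo c φ k ≤ 2 * n k ∧ 2 * n k + hi c φ k < (φ k + 1) * p := by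
  rw [idxBox7, Fintype.mem_piFinset] at hn
  exact b_bounds2 (hP c φ hφ k) (hn k)

/-- **The arc set lies in the block cell set.** [folklore] -/
theorem blockArcSet7_subset : blockArcSet7 p P lo hi ⊆ blockCells7 p P lo hi := by
  intro x hx
  simp only [blockArcSet7, mem_biUnion, mem_univ, true_and, mem_image] at hx
  obtain ⟨c, φ, hφ, n, hn, rfl⟩ := hx
  rw [mem_blockCells7]
  refine ⟨φ, hφ, fun k => ?_⟩
  obtain ⟨h0, hp', h1, h2⟩ := idx_bounds7 hP c hφ hn k
  simp only [InBlk, ofIdx7, PhaseArcs.val_cast_of_bounds h0 hp']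
  exact ⟨h1, h2⟩

omit [Fact (1 < p)] in
/-- The element map is injective on an index box. [folklore] -/
theorem injOn_idxBox7 (c : Fin 3 × Fin 3) {φ : Fin 6 → ℤ} (hφ : φ ∈ P c) :
    Set.InjOn (fun n : Fin 6 → ℤ => (c, ofIdx7 p n)) (idxBox7 p φ (lo c φ) (hi c φ) : Set (Fin 6 → ℤ)) := by
  intro n hn n' hn' e
  rw [mem_coe] at hn hn'
  simp only [Prod.mk.injEq, true_and, ofIdx7, Z7.mk.injEq] at e
  funext k
  have hb := idx_bounds7 hP c hφ hn k
  have hb' := idx_bounds7 hP c hφ hn' k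
  have ek := congrArg (fun f : Fin 6 → ZMod p => ((f k).val : ℤ)) e
  simpa only [PhaseArcs.val_cast_of_bounds hb.1 hb.2.1, PhaseArcs.val_cast_of_bounds hb'.1 hb'.2.1] using ek

/-- **Exact count of the arc set**: `Σ_c Σ_{φ ∈ P c} Π_k len_k`. [folklore] -/
theorem card_blockArcSet7 : #(blockArcSet7 p P lo hi) = ∑ c, ∑ φ ∈ P c, blkCount7 p φ (lo c φ) (hi c φ) := by
  rw [blockArcSet7, card_biUnion]
  · refine sum_congr rfl fun c _ => ?_
    rw [card_biUnion]
    · refine sum_congr rfl fun φ hφ => ?_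
      rw [card_image_of_injOn (injOn_idxBox7 hP c hφ), idxBox7, Fintype.card_piFinset, blkCount7]
      refine Finset.prod_congr rfl fun k _ => ?_
      rw [Int.card_Icc]
      rfl
    · -- blocks of distinct phase vectors in one column are disjoint
      intro φ hφ φ' hφ' hne
      rw [Function.onFun, disjoint_left]
      intro x hx hx'
      rw [mem_image] at hx hx'
      obtain ⟨n, hn, rfl⟩ := hx
      obtain ⟨n', hn', e⟩ := hx'
      simp only [Prod.mk.injEq, true_and, ofIdx7, Z7.mk.injEq] at e
      apply hne
      funext k
      have hb := idx_bounds7 hP c hφ hn k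
      have hb' := idx_bounds7 hP c hφ' hn' k
      have ek := congrArg (fun f : Fin 6 → ZMod p => ((f k).val : ℤ)) e
      simp only [PhaseArcs.val_cast_of_bounds hb.1 hb.2.1, PhaseArcs.val_cast_of_bounds hb'.1 hb'.2.1] at ek
      have hl := hP c φ hφ k; have hl' := hP c φ' hφ' k
      have hp0 : (0 : ℤ) < p := by have := NeZero.pos p; exact_mod_cast this
      by_contra hne1
      rcases lt_or_gt_of_ne hne1 with hlt | hlt
      · have : (φ k + 1) * (p : ℤ) ≤ φ' k * p := by nlinarith
        omega
      · have : (φ' k + 1) * (p : ℤ) ≤ φ k * p := by nlinarith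
        omega
  · -- different columns give disjoint sets
    intro c _ c' _ hne
    rw [Function.onFun, disjoint_left]
    intro x hx hx'
    simp only [mem_biUnion, mem_image] at hx hx'
    obtain ⟨φ, -, n, -, rfl⟩ := hx
    obtain ⟨φ', -, n', -, e⟩ := hx'
    simp only [Prod.mk.injEq] at e
    exact hne e.1.symm

end

end Cyclo7

end Summit.MatrixMultiplication.OmegaCensus
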